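import Literature.MathematicalPhysics.QuantumLattice.PeriodicMarkovEntropyBound
import Literature.MathematicalPhysics.QuantumLattice.FermionConditionalFreeEnergySectorCertificate
import Literature.MathematicalPhysics.QuantumLattice.EmeryThreeBandThermalCapFromGroundStateFloor
import Literature.MathematicalPhysics.QuantumLattice.EmeryThreeBandCuO4ClusterDictionary
import Literature.MathematicalPhysics.QuantumLattice.HubbardRectangularTorus
import HarnessLib

/-!
# The ENTROPY-RESOLVED `T > 0` cap of the three-band (Emery) `CuO₂` model from the `CuO₄` plus: the Markov / conditional-entropy bound
# `P_cell(β,θ) ≤ sup_σ [S(σ_plus) − S(σ_Y) − (β/M) tr σ H^{w_M}_plus]`, its Poulin–Hastings certificate form, and the KERNEL corollary from sector floors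

Topic `Literature/MathematicalPhysics/QuantumLattice` (family `hubbard`; crew hubbard-fast S2 «multi-band, T > 0», seat hubbard-box-p1). Every typed `T > 0` cap word
of the three-band model so far (`EmeryThreeBandThermalCapFromGroundStateFloor`, hubbard-downfold-mod-4's `EmeryThermalCapFromFloorSeam` / `…RetiltBoxp1`) is the
FLAT bound `P_cell ≤ −β·(floor) + 6 log 2`: the maximal entropy `6 log 2` per `CuO₂` is never reduced, because the plus clusters OVERLAP (each in-plane
oxygen belongs to two pluses) and the tree's cluster caps (`emeryCellPressure_le_log_partitionFn_boost`) need a TILING cluster (`Cu₄O₈`, no tables). The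
Markov bound of `PeriodicMarkovEntropyBound` handles overlaps by strong subadditivity: reading the four sites of the `2×2` cell in lexicographic order through
the chain of windows `Y = {O(1,2), O(2,1)} ⊂ Y+Cu(2,2) ⊂ Y+Cu+O(2,3) ⊂ W₅ = Y+Cu+O(2,3)+O(3,2)` (the dummy site read alone) gives, per `CuO₂`,

  `s_cell(ω) − 2 log 2 ≤ S(ω|W₅) − S(ω|Y)`  for every `2×2`-periodic `ω`, hence (energy identity of the uniform weight of mass `M` on `W₅`)

* §2 **`emeryCellPressure_le_of_plusMarkov`**: `emeryCellPressure β θ ≤ c₀` whenever `S(ω|W₅) − S(ω|Y) − (β/M)·Re ω(H^{w_M}_{W₅}[θ] + G) ≤ c₀` for all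
  periodic `ω` (`G` killed by periodic states);
* §3 **`emeryCellPressure_le_of_plusMarkovCertificate`**: the Poulin–Hastings matrix certificate `e^c·exp(L) − tr_{W₅→Y} exp(−(β/M)(H^{w_M}_{W₅} + G) + Γ L) ⪰ 0`
  (`L ∈ 𝔄_Y` Hermitian, `16 × 16`) gives `emeryCellPressure β θ ≤ c` — the C1-type `T > 0` certificate door for the three-band model, previously open
  only for one-band tori;
* §4 **`emeryCellPressure_le_log_of_gpSectorFloors`** (NO new computation): kernel sector floors `q k ≤ E₀(hubbardOpenBoxGP 1 5 (plusTau θ M) (plusUps θ M)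
  (plusNu θ M), k)` (`k ≤ 10`; hubbard-box-p2's `kgp1x5_*_table`) give, for `β ≥ 0`, `M > 0` and any `F` with
  `Σ_{j ≤ 6} C(6,j)·e^{−(β/M)·q(j+n)} ≤ F` (`n ≤ 4`):  **`emeryCellPressure β θ ≤ log F`**; §5 `…_le_flat_of_gpSectorFloors`: the flat word
  `6 log 2 − β q₀/M` is the special case `F = 64·e^{−(β/M) q₀}` — the entropy-resolved cap is never worse, and its `β → ∞` constant is at most
  `log max_n C(6,·)`-weighted, e.g. `log 20` instead of `log 64` when one sector binds.

Everything is PROVED (0 sorry); no definition, no named fact, no number. HONEST SCOPE: the cap still carries the `O(1)` cluster entropy; what it removes is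
the part of the `6 log 2` excluded by the sector structure of the certified floors (and, with `L ≠ 0` certificates, whatever a dual optimiser finds).

## Tree / Mathlib search

REUSED: `FermionInteraction.perVarPressure_le_of_markov` (`PeriodicMarkovEntropyBound`); `fermion_condFreeEnergy_le_of_certificate_lowerSet`,
`fermion_condFreeEnergy_cardDiagonal_le_log_lowerSet`, `posSemidef_sub_cardDiagonal_of_forall_le_groundEnergy` (`FermionConditionalFreeEnergySectorCertificate`);
`emeryCellPressure`, `emeryPressure`, `card_cell_liebPeriods_eq`, `emeryInteraction_structure`, `emeryWindow_fit_of_cuO4_subset`, `uniformPeriodicWeight(_admissible/_empty)`,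
`emeryCuO4Window`, `mem_emeryCuO4Window_iff`, `plusSite(_mem/_plusRank)`, `cuO4SiteEquiv`, `relabel_cuO4_uniform_emeryInteraction`, `hubbardOpenBoxGP_commute_totalNumber`,
`hubbardOpenBoxGP_isHermitian`, `plusTau_symm`, `groundEnergy_relabel`, `relabel_diagonal`, `totalNumber_eq_diagonal_card`, `fermionPartialTrace_incl_rdm`, `trace_rdm_mul`,
`expect_re_nonneg_of_posSemidef`, `cellRes`, `Pi.toLex_monotone`. `lean search 'Markov.*emery|emeryCellPressure_le_log|plusMarkov'` (2026-08-28): nothing.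

## References

* D. Poulin, M. B. Hastings, Phys. Rev. Lett. 106 (2011) 080403, eqs. (3)–(8). [cite: PoulinHastings2011, eqs. (3)–(8)]
* H. Araki, H. Moriya, Rev. Math. Phys. 15 (2003) 93, Theorem 3.8 and §10. [cite: ArakiMoriya2003, Theorem 3.8 and §10]
* R. Valentí, J. Stolze, P. J. Hirschfeld, Phys. Rev. B 43 (1991) 13743, §II (weighted `CuO₄` clusters). [cite: ValentiStolzeHirschfeld1991, §II]
* V. J. Emery, Phys. Rev. Lett. 58 (1987) 2794, eq. (1). [cite: Emery1987, eq. (1)]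
* R. B. Israel, *Convexity in the Theory of Lattice Gases* (1979), Thm. I.2.4. [cite: Israel1979, Thm. I.2.4]
-/

noncomputable section

open scoped ComplexOrder BigOperators
open Finset

namespace Literature.MathematicalPhysics.QuantumLattice

open Matrix HubbardWave0 Literature.Probability.LatticeModels ThermodynamicLimit InfVolFermionState ClusterLowerBound
open Literature.InformationTheory.Entropy (vonNeumannEntropy)

/-! ### §1. The plus chain: shield `Y = {(1,2),(2,1)}`, corners Cu `(2,2)`, O `(2,3)`, O `(3,2)` -/

/-- Lexicographic comparison on `ℤ²` from the first coordinate. [folklore] -/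
private theorem toLex_lt_of_apply_zero_lt {x y : Site 2} (h : x 0 < y 0) : toLex x < toLex y :=
  show Pi.Lex (· < ·) (· < ·) x y from ⟨0, fun j hj => absurd hj (Fin.not_lt_zero j), h⟩

/-- Lexicographic comparison on `ℤ²` from the second coordinate when the first coordinates agree. [folklore] -/
private theorem toLex_lt_of_apply_one_lt {x y : Site 2} (h0 : x 0 = y 0) (h1 : x 1 < y 1) : toLex x < toLex y :=
  show Pi.Lex (· < ·) (· < ·) x y from
    ⟨1, fun j hj => by
      fin_cases j
      · exact h0
      · exact absurd hj (lt_irrefl _), h1⟩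

/-- Lexicographic comparison on `ℤ²` from coordinatewise comparison. [folklore] -/
private theorem toLex_le_of_apply_le {x y : Site 2} (h0 : x 0 ≤ y 0) (h1 : x 1 ≤ y 1) : toLex x ≤ toLex y :=
  Pi.toLex_monotone (Fin.forall_fin_two.2 ⟨h0, h1⟩)

/-- The five sites of the plus window. [cite: ValentiStolzeHirschfeld1991, §II] -/
private theorem eq_of_mem_emeryCuO4Window {y : Site 2} (hy : y ∈ emeryCuO4Window) :
    y = ![1, 2] ∨ y = ![2, 1] ∨ y = ![2, 2] ∨ y = ![2, 3] ∨ y = ![3, 2] := by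
  obtain ⟨k, rfl⟩ : ∃ k, plusSite k = y := ⟨plusRank y, plusSite_plusRank hy⟩
  fin_cases k <;> simp [plusSite]

/-- The plus window as the top of the chain. [cite: ValentiStolzeHirschfeld1991, §II] -/
private theorem emeryCuO4Window_eq_chain :
    emeryCuO4Window = insert (![3, 2] : Site 2) (insert (![2, 3] : Site 2) (insert (![2, 2] : Site 2) ({![1, 2], ![2, 1]} : Finset (Site 2)))) := by
  ext y
  constructor
  · intro hy
    rcases eq_of_mem_emeryCuO4Window hy with rfl | rfl | rfl | rfl | rfl <;> simp
  · intro hy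
    simp only [Finset.mem_insert, Finset.mem_singleton] at hy
    rcases hy with rfl | rfl | rfl | rfl | rfl <;> decide

/-- The shield lies in the plus. [cite: ValentiStolzeHirschfeld1991, §II] -/
theorem emeryPlusShield_subset : ({![1, 2], ![2, 1]} : Finset (Site 2)) ⊆ emeryCuO4Window := by
  intro y hy
  simp only [Finset.mem_insert, Finset.mem_singleton] at hy
  rcases hy with rfl | rfl <;> decide

/-- The shield is closed downwards in the lexicographic order of the plus (it consists of the two smallest sites). [cite: PoulinHastings2011, eq. (3)] -/
theorem emeryPlusShield_lower :
    ∀ x ∈ ({![1, 2], ![2, 1]} : Finset (Site 2)), ∀ y ∈ emeryCuO4Window, toLex y ≤ toLex x → y ∈ ({![1, 2], ![2, 1]} : Finset (Site 2)) := by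
  intro x hx y hy hyx
  simp only [Finset.mem_insert, Finset.mem_singleton] at hx ⊢
  rcases eq_of_mem_emeryCuO4Window hy with rfl | rfl | rfl | rfl | rfl
  · exact Or.inl rfl
  · exact Or.inr rfl
  · exfalso
    rcases hx with rfl | rfl
    · exact absurd hyx (not_le.2 (toLex_lt_of_apply_zero_lt (by simp)))
    · exact absurd hyx (not_le.2 (toLex_lt_of_apply_one_lt (by simp) (by simp)))
  · exfalso
    rcases hx with rfl | rfl
    · exact absurd hyx (not_le.2 (toLex_lt_of_apply_zero_lt (by simp)))
    · exact absurd hyx (not_le.2 (toLex_lt_of_apply_one_lt (by simp) (by simp)))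
  · exfalso
    rcases hx with rfl | rfl
    · exact absurd hyx (not_le.2 (toLex_lt_of_apply_zero_lt (by simp)))
    · exact absurd hyx (not_le.2 (toLex_lt_of_apply_zero_lt (by simp)))

/-! ### §2. The Markov cap of the plus: abstract form -/

/-- **THE MARKOV CAP OF THE PLUS (abstract form).** For the uniform `(2ℤ)²`-weight of mass `M > 0` on the plus `W₅`, a multiplier `G ∈ 𝔄_{W₅}` killed by
`2×2`-periodic states and a real `β`: if `S(ω|W₅) − S(ω|Y) − (β/M)·Re ω(H^{w_M}_{W₅}[emeryInteraction θ] + G) ≤ c₀` for every `2×2`-periodic `ω`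
(`Y = {(1,2),(2,1)}` the two incoming oxygens), then `emeryCellPressure β θ ≤ c₀`. [cite: PoulinHastings2011, eqs. (3)–(8)] [cite: ValentiStolzeHirschfeld1991, §II] -/
theorem emeryCellPressure_le_of_plusMarkov (θ : Fin 14 → ℝ) {M : ℝ} (hM : 0 < M) (β : ℝ) {G : FermionOp emeryCuO4Window}
    (hG0 : ∀ ω' : InfVolFermionState 2, ω'.IsPeriodic liebPeriods → (ω'.expect emeryCuO4Window G).re = 0) {c₀ : ℝ}
    (hvar : ∀ ω : InfVolFermionState 2, ω.IsPeriodic liebPeriods →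
      vonNeumannEntropy (ω.rdm emeryCuO4Window) - vonNeumannEntropy (ω.rdm ({![1, 2], ![2, 1]} : Finset (Site 2))) -
        β / M * (ω.expect emeryCuO4Window
          (((⟨fun X => (uniformPeriodicWeight liebPeriods emeryCuO4Window M X : ℂ) • (emeryInteraction θ).Φ X⟩ : FermionInteraction 2).localHamiltonian
            emeryCuO4Window) + G)).re ≤ c₀) :
    emeryCellPressure β θ ≤ c₀ := by
  classical
  obtain ⟨-, -, hP, hR⟩ := emeryInteraction_structure θ
  -- the chain data
  set sCu : Site 2 := ![2, 2] with hsCu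
  set sOy : Site 2 := ![2, 3] with hsOy
  set sOx : Site 2 := ![3, 2] with hsOx
  set Y : Finset (Site 2) := {![1, 2], ![2, 1]} with hY
  set cCu : Cell liebPeriods := cellRes liebPeriods sCu with hcCu
  set cOy : Cell liebPeriods := cellRes liebPeriods sOy with hcOy
  set cOx : Cell liebPeriods := cellRes liebPeriods sOx with hcOx
  have hne1 : cCu ≠ cOy := by rw [hcCu, hcOy, hsCu, hsOy]; decide
  have hne2 : cCu ≠ cOx := by rw [hcCu, hcOx, hsCu, hsOx]; decide
  have hne3 : cOy ≠ cOx := by rw [hcOy, hcOx, hsOy, hsOx]; decide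
  set T : Finset (Cell liebPeriods) := {cCu, cOy, cOx} with hT
  set a : Cell liebPeriods → Site 2 := fun c => if c = cCu then sCu else if c = cOy then sOy else sOx with ha
  set W : Cell liebPeriods → Finset (Site 2) := fun c =>
    if c = cCu then insert sCu Y else if c = cOy then insert sOy (insert sCu Y) else insert sOx (insert sOy (insert sCu Y)) with hW
  have haCu : a cCu = sCu := by simp [ha]
  have haOy : a cOy = sOy := by simp [ha, hne1.symm]
  have haOx : a cOx = sOx := by simp [ha, hne2.symm, hne3.symm]
  have hWCu : W cCu = insert sCu Y := by simp [hW]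
  have hWOy : W cOy = insert sOy (insert sCu Y) := by simp [hW, hne1.symm]
  have hWOx : W cOx = insert sOx (insert sOy (insert sCu Y)) := by simp [hW, hne2.symm, hne3.symm]
  have hTmem : ∀ c ∈ T, c = cCu ∨ c = cOy ∨ c = cOx := fun c hc => by simpa [hT] using hc
  have hres : ∀ c ∈ T, cellRes liebPeriods (a c) = c := by
    intro c hc
    rcases hTmem c hc with rfl | rfl | rfl
    · rw [haCu]
    · rw [haOy]
    · rw [haOx]
  have haW : ∀ c ∈ T, a c ∈ W c := by
    intro c hc
    rcases hTmem c hc with rfl | rfl | rfl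
    · rw [haCu, hWCu]; exact Finset.mem_insert_self _ _
    · rw [haOy, hWOy]; exact Finset.mem_insert_self _ _
    · rw [haOx, hWOx]; exact Finset.mem_insert_self _ _
  have hmax : ∀ c ∈ T, ∀ y ∈ W c, toLex y ≤ toLex (a c) := by
    intro c hc y hy
    rcases hTmem c hc with rfl | rfl | rfl
    · rw [haCu]
      rw [hWCu, hY] at hy
      simp only [Finset.mem_insert, Finset.mem_singleton] at hy
      rcases hy with rfl | rfl | rfl
      · exact le_rfl
      · exact (toLex_lt_of_apply_zero_lt (by simp [hsCu])).le
      · exact toLex_le_of_apply_le (by simp [hsCu]) (by simp [hsCu])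
    · rw [haOy]
      rw [hWOy, hY] at hy
      simp only [Finset.mem_insert, Finset.mem_singleton] at hy
      rcases hy with rfl | rfl | rfl | rfl
      · exact le_rfl
      · exact toLex_le_of_apply_le (by simp [hsCu, hsOy]) (by simp [hsCu, hsOy])
      · exact (toLex_lt_of_apply_zero_lt (by simp [hsOy])).le
      · exact toLex_le_of_apply_le (by simp [hsOy]) (by simp [hsOy])
    · rw [haOx]
      rw [hWOx, hY] at hy
      simp only [Finset.mem_insert, Finset.mem_singleton] at hy
      rcases hy with rfl | rfl | rfl | rfl | rfl
      · exact le_rfl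
      · exact (toLex_lt_of_apply_zero_lt (by simp [hsOx, hsOy])).le
      · exact (toLex_lt_of_apply_zero_lt (by simp [hsOx, hsCu])).le
      · exact (toLex_lt_of_apply_zero_lt (by simp [hsOx])).le
      · exact (toLex_lt_of_apply_zero_lt (by simp [hsOx])).le
  have hTcard : T.card = 3 := by
    rw [hT, Finset.card_insert_of_notMem (by simp [hne1, hne2]), Finset.card_insert_of_notMem (by simp [hne3]), Finset.card_singleton]
  -- telescoping of the chain for a given state
  have hsCuY : sCu ∉ Y := by rw [hsCu, hY]; decide
  have hsOyW : sOy ∉ insert sCu Y := by rw [hsOy, hsCu, hY]; decide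
  have hsOxW : sOx ∉ insert sOy (insert sCu Y) := by rw [hsOx, hsOy, hsCu, hY]; decide
  have htop : insert sOx (insert sOy (insert sCu Y)) = emeryCuO4Window := by
    rw [emeryCuO4Window_eq_chain]
  have htel : ∀ ω : InfVolFermionState 2,
      ∑ c ∈ T, (vonNeumannEntropy (ω.rdm (W c)) - vonNeumannEntropy (ω.rdm ((W c).erase (a c)))) =
        vonNeumannEntropy (ω.rdm emeryCuO4Window) - vonNeumannEntropy (ω.rdm Y) := by
    intro ω
    rw [hT, Finset.sum_insert (by simp [hne1, hne2]), Finset.sum_insert (by simp [hne3]), Finset.sum_singleton,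
      haCu, haOy, haOx, hWCu, hWOy, hWOx, Finset.erase_insert hsCuY, Finset.erase_insert hsOyW, Finset.erase_insert hsOxW, htop]
    ring
  -- the generic Markov cap
  have h := (emeryInteraction θ).perVarPressure_le_of_markov (q := liebPeriods) (R := 1) (by norm_num) hP hR T a W hres haW hmax
    emeryCuO4Window (uniformPeriodicWeight liebPeriods emeryCuO4Window M) hM.ne'
    (uniformPeriodicWeight_admissible emeryCuO4Window M (emeryWindow_fit_of_cuO4_subset θ subset_rfl)) hG0 β
    (c₀ := c₀) (fun ω hω => by rw [htel ω]; exact hvar ω hω)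
  rw [uniformPeriodicWeight_empty, zero_mul, mul_zero, add_zero, card_cell_liebPeriods_eq, hTcard] at h
  have hlog : Real.log 4 = 2 * Real.log 2 := by
    rw [show (4 : ℝ) = 2 ^ 2 by norm_num, Real.log_pow]
    norm_num
  rw [emeryCellPressure, emeryPressure]
  push_cast at h
  linarith

/-! ### §3. The certificate form: a Poulin–Hastings dual on the plus with the two-oxygen shield -/

/-- A real multiple of a Hermitian matrix is Hermitian. [folklore] -/
private theorem isHermitian_ofReal_smul' {m : Type*} {K : Matrix m m ℂ} (hK : K.IsHermitian) (c : ℝ) : ((c : ℂ) • K).IsHermitian := by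
  rw [Matrix.IsHermitian, Matrix.conjTranspose_smul, hK.eq, Complex.star_def, Complex.conj_ofReal]

/-- **THE MARKOV CERTIFICATE DOOR OF THE THREE-BAND MODEL.** Let `M > 0`, `β` real, `G ∈ 𝔄_{W₅}` Hermitian and killed by `2×2`-periodic states, `L ∈ 𝔄_Y`
Hermitian (`Y = {(1,2),(2,1)}`, a `16 × 16` matrix) and `c` real with the Poulin–Hastings certificate
`e^c · exp(L) − tr_{W₅→Y} exp(−(β/M)·(H^{w_M}_{W₅}[emeryInteraction θ] + G) + Γ L) ⪰ 0`. Then `emeryCellPressure β θ ≤ c`.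
[cite: PoulinHastings2011, eqs. (3)–(8)] [cite: ValentiStolzeHirschfeld1991, §II] -/
theorem emeryCellPressure_le_of_plusMarkovCertificate (θ : Fin 14 → ℝ) {M : ℝ} (hM : 0 < M) (β : ℝ) {G : FermionOp emeryCuO4Window}
    (hGh : G.IsHermitian) (hG0 : ∀ ω' : InfVolFermionState 2, ω'.IsPeriodic liebPeriods → (ω'.expect emeryCuO4Window G).re = 0)
    {L : FermionOp ({![1, 2], ![2, 1]} : Finset (Site 2))} (hL : L.IsHermitian) {c : ℝ}
    (hcert : ((Real.exp c : ℂ) • cfc Real.exp L -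
      fermionPartialTrace (PolySite.incl emeryPlusShield_subset)
        (cfc Real.exp
          (-(((β / M : ℝ) : ℂ) •
              ((⟨fun X => (uniformPeriodicWeight liebPeriods emeryCuO4Window M X : ℂ) • (emeryInteraction θ).Φ X⟩ : FermionInteraction 2).localHamiltonian
                emeryCuO4Window + G)) +
            fermionEmbed (PolySite.incl emeryPlusShield_subset) L))).PosSemidef) :
    emeryCellPressure β θ ≤ c := by
  obtain ⟨hH, -, -, -⟩ := emeryInteraction_structure θ
  have hKh := ((FermionInteraction.localHamiltonian_isHermitian (hH.reweight (uniformPeriodicWeight liebPeriods emeryCuO4Window M))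
    emeryCuO4Window).add hGh)
  refine emeryCellPressure_le_of_plusMarkov θ hM β hG0 fun ω hω => ?_
  have h := fermion_condFreeEnergy_le_of_certificate_lowerSet emeryPlusShield_subset emeryPlusShield_lower (ω.rdm_posSemidef _) (ω.trace_rdm _)
    (isHermitian_ofReal_smul' hKh (β / M)) hL hcert
  rw [ω.fermionPartialTrace_incl_rdm emeryPlusShield_subset, Matrix.mul_smul, Matrix.trace_smul, smul_eq_mul, Complex.re_ofReal_mul,
    ω.trace_rdm_mul] at h
  exact h

/-! ### §4. The kernel corollary: sector floors of the plus give an entropy-resolved cap -/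

/-- `relabel` fixes the particle-number operator. [cite: BratteliRobinsonII1997, §5.2.2, Thm. 5.2.5] -/
private theorem relabel_totalNumber {Λ Λ' : Type*} [LinearOrder Λ] [Fintype Λ] [LinearOrder Λ'] [Fintype Λ'] (e : Orb Λ ≃ Orb Λ') :
    relabel e (totalNumber : Matrix (Finset (Orb Λ)) (Finset (Orb Λ)) ℂ) = totalNumber := by
  rw [totalNumber_eq_diagonal_card, totalNumber_eq_diagonal_card, relabel_diagonal]
  congr 1
  funext s
  rw [Equiv.finsetCongr_symm, Equiv.finsetCongr_apply, Finset.card_map]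

/-- **THE ENTROPY-RESOLVED `T > 0` CAP FROM KERNEL SECTOR FLOORS.** Let `M > 0`, `β ≥ 0`, and `q k ≤ E₀(hubbardOpenBoxGP 1 5 (plusTau θ M) (plusUps θ M)
(plusNu θ M), k)` for every particle number `k ≤ 10` (hubbard-box-p2's kernel sector tables of the uniformly weighted plus). If `F > 0` satisfies
`Σ_{j ≤ 6} C(6, j) · exp(−(β/M)·q(j+n)) ≤ F` for `n = 0, …, 4`, then **`emeryCellPressure β θ ≤ log F`**. (The six traced orbitals are those of
Cu(2,2), O(2,3), O(3,2); `n` is the particle number on the shield `Y`.) [cite: PoulinHastings2011, eqs. (3)–(8)] [cite: arXiv9311033, §2]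
[cite: ValentiStolzeHirschfeld1991, §II] -/
theorem emeryCellPressure_le_log_of_gpSectorFloors (θ : Fin 14 → ℝ) {M : ℝ} (hM : 0 < M) {β : ℝ} (hβ : 0 ≤ β) (q : ℕ → ℝ)
    (hq : ∀ k ≤ 10, q k ≤ groundEnergy (hubbardOpenBoxGP 1 5 (plusTau θ M) (plusUps θ M) (plusNu θ M)) k) {F : ℝ} (hF0 : 0 < F)
    (hF : ∀ n ≤ 4, ∑ j ∈ Finset.range 7, ((Nat.choose 6 j : ℕ) : ℝ) * Real.exp (-(β / M * q (j + n))) ≤ F) :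
    emeryCellPressure β θ ≤ Real.log F := by
  obtain ⟨hH, -, -, -⟩ := emeryInteraction_structure θ
  set Hw : FermionOp emeryCuO4Window :=
    ((⟨fun X => (uniformPeriodicWeight liebPeriods emeryCuO4Window M X : ℂ) • (emeryInteraction θ).Φ X⟩ : FermionInteraction 2).localHamiltonian
      emeryCuO4Window) with hHw
  have hHwh : Hw.IsHermitian := FermionInteraction.localHamiltonian_isHermitian (hH.reweight _) _
  -- particle-number conservation and sector floors, transported from `hubbardOpenBoxGP` through the dictionary
  have hrel : relabel (Orb.mapEquiv cuO4SiteEquiv) Hw = hubbardOpenBoxGP 1 5 (plusTau θ M) (plusUps θ M) (plusNu θ M) :=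
    relabel_cuO4_uniform_emeryInteraction θ M
  have hHN : Commute Hw totalNumber := by
    have h := hubbardOpenBoxGP_commute_totalNumber (plusTau θ M) (plusUps θ M) (plusNu θ M)
    rw [← hrel, ← relabel_totalNumber (Orb.mapEquiv cuO4SiteEquiv)] at h
    have h' := congrArg (relabel (Orb.mapEquiv cuO4SiteEquiv).symm) h.eq
    rw [map_mul, map_mul, relabel_symm_relabel, relabel_symm_relabel] at h'
    exact h'
  have hcard : Fintype.card (PolySite emeryCuO4Window) = 5 := by
    rw [Fintype.card_coe, lexSites, Finset.card_map, card_emeryCuO4Window]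
  have hq' : ∀ N ≤ 2 * Fintype.card (PolySite emeryCuO4Window), q N ≤ groundEnergy Hw N := by
    intro N hN
    rw [hcard] at hN
    rw [← groundEnergy_relabel (Orb.mapEquiv cuO4SiteEquiv) Hw N, hrel]
    exact hq N hN
  have hPSD := posSemidef_sub_cardDiagonal_of_forall_le_groundEnergy hHwh hHN q hq'
  -- cardinalities of the shield and of its complement
  have hYcard : ({![1, 2], ![2, 1]} : Finset (Site 2)).card = 2 := by decide
  have hAcard : (emeryCuO4Window \ ({![1, 2], ![2, 1]} : Finset (Site 2))).card = 3 := by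
    rw [Finset.card_sdiff_of_subset emeryPlusShield_subset, card_emeryCuO4Window, hYcard]
  refine emeryCellPressure_le_of_plusMarkov θ hM β (G := 0) (fun ω' _ => by rw [map_zero, Complex.zero_re]) fun ω hω => ?_
  rw [add_zero]
  -- the diagonal certificate
  have h1 := fermion_condFreeEnergy_cardDiagonal_le_log_lowerSet emeryPlusShield_subset emeryPlusShield_lower (fun k => β / M * q k) hF0
    (fun n hn => by
      rw [hAcard]
      rw [hYcard] at hn
      exact hF n (by omega)) (ω.rdm_posSemidef emeryCuO4Window) (ω.trace_rdm _)
  rw [ω.fermionPartialTrace_incl_rdm emeryPlusShield_subset, ω.trace_rdm_mul] at h1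
  -- the energy: `(β/M)·Re ω(H^w) ≥ Re ω(diag (β/M) q(|u|))`
  have h2 := ω.expect_re_nonneg_of_posSemidef emeryCuO4Window hPSD
  rw [map_sub, Complex.sub_re] at h2
  have h3 : (ω.expect emeryCuO4Window (diagonal fun u : Finset (Orb (PolySite emeryCuO4Window)) => (((β / M * q u.card : ℝ)) : ℂ))).re =
      β / M * (ω.expect emeryCuO4Window (diagonal fun u : Finset (Orb (PolySite emeryCuO4Window)) => ((q u.card : ℝ) : ℂ))).re := by
    have e : (diagonal fun u : Finset (Orb (PolySite emeryCuO4Window)) => (((β / M * q u.card : ℝ)) : ℂ)) =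
        ((β / M : ℝ) : ℂ) • diagonal fun u : Finset (Orb (PolySite emeryCuO4Window)) => ((q u.card : ℝ) : ℂ) := by
      rw [← Matrix.diagonal_smul]
      congr 1
      funext u
      push_cast
      rfl
    rw [e, map_smul, smul_eq_mul, Complex.re_ofReal_mul]
  have h4 : β / M * (ω.expect emeryCuO4Window (diagonal fun u : Finset (Orb (PolySite emeryCuO4Window)) => ((q u.card : ℝ) : ℂ))).re ≤
      β / M * (ω.expect emeryCuO4Window Hw).re :=
    mul_le_mul_of_nonneg_left (by linarith) (div_nonneg hβ hM.le)
  linarith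

/-! ### §5. The flat word is the special case `F = 64·e^{−(β/M) q₀}` -/

/-- **Never worse than the flat cap**: if all sector floors are at least `q₀` (`q k ≥ q₀`, `k ≤ 10`), then the entropy-resolved cap with
`F = 64·e^{−(β/M)·q₀}` returns the flat word `emeryCellPressure β θ ≤ 6 log 2 − β·q₀/M` of `emeryCellPressure_le_of_cuO4Certificate` (`β ≥ 0`, `M > 0`).
[cite: Israel1979, Thm. I.2.4] [cite: arXiv9311033, §2] -/
theorem emeryCellPressure_le_flat_of_gpSectorFloors (θ : Fin 14 → ℝ) {M : ℝ} (hM : 0 < M) {β : ℝ} (hβ : 0 ≤ β) (q : ℕ → ℝ)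
    (hq : ∀ k ≤ 10, q k ≤ groundEnergy (hubbardOpenBoxGP 1 5 (plusTau θ M) (plusUps θ M) (plusNu θ M)) k) {q₀ : ℝ} (hq₀ : ∀ k ≤ 10, q₀ ≤ q k) :
    emeryCellPressure β θ ≤ 6 * Real.log 2 - β * (q₀ / M) := by
  have hF0 : 0 < 64 * Real.exp (-(β / M * q₀)) := by positivity
  have h := emeryCellPressure_le_log_of_gpSectorFloors θ hM hβ q hq hF0 fun n hn => by
    have hterm : ∀ j ∈ Finset.range 7, ((Nat.choose 6 j : ℕ) : ℝ) * Real.exp (-(β / M * q (j + n))) ≤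
        ((Nat.choose 6 j : ℕ) : ℝ) * Real.exp (-(β / M * q₀)) := by
      intro j hj
      have hjn : j + n ≤ 10 := by have := Finset.mem_range.1 hj; omega
      refine mul_le_mul_of_nonneg_left (Real.exp_le_exp.2 ?_) (by positivity)
      have := mul_le_mul_of_nonneg_left (hq₀ (j + n) hjn) (div_nonneg hβ hM.le)
      linarith
    refine (Finset.sum_le_sum hterm).trans ?_
    rw [← Finset.sum_mul]
    have hsum : ∑ j ∈ Finset.range 7, ((Nat.choose 6 j : ℕ) : ℝ) = 64 := by
      have h := Nat.sum_range_choose 6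
      have h' : ((∑ j ∈ Finset.range 7, Nat.choose 6 j : ℕ) : ℝ) = ((2 ^ 6 : ℕ) : ℝ) := by exact_mod_cast h
      push_cast at h'
      linarith
    rw [hsum]
  have hlog : Real.log (64 * Real.exp (-(β / M * q₀))) = 6 * Real.log 2 - β * (q₀ / M) := by
    rw [Real.log_mul (by norm_num) (Real.exp_pos _).ne', Real.log_exp, show (64 : ℝ) = 2 ^ 6 by norm_num, Real.log_pow]
    push_cast
    ring
  rw [hlog] at h
  exact h

end Literature.MathematicalPhysics.QuantumLattice

end
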